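import Summits.CriticalPhenomena.PercolationContinuityZ3.Theorems.PercNearOneGluingNoHeavyLowerTailKnQuestion8CoefficientwiseCoreClassKernelMixBundleWords
import Summits.CriticalPhenomena.PercolationContinuityZ3.Theorems.PercNearOneGluingNoHeavyLowerTailKnQuestion8CoefficientwiseCoreClassKernelMixFibreFlowsJoins
import Summits.CriticalPhenomena.PercolationContinuityZ3.Theorems.PercNearOneGluingNoHeavyLowerTailKnQuestion8CoefficientwiseCoreClassKernelMixIETLayerCake
import HarnessLib

/-!
# THEOREM LP1(Θ) in the kernel, I: the 0/1 counting form on a bundle for thread-supported levels (vanishing base)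

Support file (`--supports stmt-CriticalPhenomena-4575`, closed), prover `prim-cplus-coupling` (gen 43).  No definitions, no notations, no named facts,
no sorries; standard axioms.  Memo `prim-cplus-coupling/A5-COUPLING-gen42.md` §7 (THEOREM LP1(Θ) for thread-supported levels), `A5-COUPLING-gen43.md`.

SETTING.  An explicit bundle `Θ(ℓ₁..ℓ_r)` (as in `…KernelMixBundleTraces`): threads `t < r` with vertices `w t 0 = u, …, w t (L t) = b`, edges `e t j`,
edge sets `A t` (pairwise disjoint), `E = ⋃ A t`; two threads `p ≠ q`.  0/1 LEVELS: `h, k, hᵃ, hᵇ, kᵃ, kᵇ : Set V → ℝ` monotone with values in `{0,1}`,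
`hᵃ, hᵇ ≤ h`, `kᵃ, kᵇ ≤ k`, THREAD-SUPPORTED: `hᵃ, hᵇ` depend only on the trace on `V(W_p) = {w p j}`, `kᵃ, kᵇ` only on the trace on `V(W_q)`, and
VANISHING BASE `hᵃ{u} = kᵃ{u} = 0` (the regime reduction `iet_regime_reduction` removes this normalisation in part II).
THEOREM `Coefficientwise.iet01_bundle_threadSupported_base`: for every up-closed event `𝒱`,
  `0 ≤ Σ_{ω ⊆ E : 𝒱, b ∈ X∖Y} h(X)k(X) + Σ_{ω ⊆ E : 𝒱, b ∈ Y∖X} (hᵃX − hᵇY)(kᵃX − kᵇY)`   (`X = C_u ω`, `Y = C_u(E∖ω)`).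
PROOF = the memo's §7: `fibre_flows_joins` (…KernelMixFibreFlowsJoins) on `P = A p`, `Q = A q`, `O =` the other threads, with the D-sense word predicates
`hro a :⟺ hᵃ(X_D a) = 1 ∧ hᵇ(Y_D a) = 0` etc. (`X_D a = {u} ∪` leading red run, `Y_D a = {u,b} ∪` leading ∪ trailing blue runs of the word `a`), the lift
'empty words ↦ full words' on `O`; the exact traces of `…KernelMixBundleWords` identify abstract and cluster `bad₁, bad₂, P₁`, and the flow images lie in the
supply `S = {b ∈ X∖Y, h(X) = k(X) = 1}` (prefix/suffix membership); finally `iet01_ge_count`.  Part II (…KernelMixBundleIET) removes the base normalisation,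
treats `p = q`, and passes to real thread-supported / thread-additive levels by the layer cake.
[cite: KozmaNitzan2024, Questions 8–9 (§5.5 p. 36) (context); Harris 1960]
-/

namespace Summit.CriticalPhenomena.PercolationContinuityZ3.Theorems

open Finset Literature.Probability.Percolation

namespace Coefficientwise

variable {ι V : Type*}

open Classical in
/-- **THEOREM LP1(Θ), 0/1 counting form with vanishing base.**  On an explicit bundle with threads `p ≠ q`, for 0/1-valued monotone levels with
`hᵃ, hᵇ ≤ h` supported on the vertices of thread `p`, `kᵃ, kᵇ ≤ k` supported on the vertices of thread `q`, and `hᵃ{u} = kᵃ{u} = 0`, the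
increasing-event transfer sum over every up-closed event `𝒱` is nonnegative (module docstring; memo gen 42 §7).
[cite: KozmaNitzan2024, Questions 8–9 (§5.5 p. 36) (context); Harris 1960] -/
theorem iet01_bundle_threadSupported_base (ends : ι → Sym2 V) (r : ℕ) (L : ℕ → ℕ) (hL : ∀ t, t < r → 1 ≤ L t)
    (w : ℕ → ℕ → V) (e : ℕ → ℕ → ι) (u b : V)
    (hw0 : ∀ t, t < r → w t 0 = u) (hwL : ∀ t, t < r → w t (L t) = b)
    (harc : ∀ t, t < r → ∀ j, 1 ≤ j → j ≤ L t → ends (e t j) = s(w t (j - 1), w t j))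
    (hwinj : ∀ t, t < r → ∀ i j, i ≤ L t → j ≤ L t → w t i = w t j → i = j)
    (hcross : ∀ t t', t < r → t' < r → t ≠ t' → ∀ i j, i ≤ L t → j ≤ L t' → w t i = w t' j → (i = 0 ∧ j = 0) ∨ (i = L t ∧ j = L t'))
    (A : ℕ → Finset ι) (hA : ∀ t, t < r → ∀ i, i ∈ A t ↔ ∃ j, 1 ≤ j ∧ j ≤ L t ∧ e t j = i)
    (hAdisj : ∀ t t', t < r → t' < r → t ≠ t' → Disjoint (A t) (A t'))
    (E : Finset ι) (hEA : ∀ i, i ∈ E ↔ ∃ t, t < r ∧ i ∈ A t)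
    (p q : ℕ) (hp : p < r) (hq : q < r) (hpq : p ≠ q)
    (𝒱 : Finset ι → Prop) (hV : ∀ ⦃s t : Finset ι⦄, s ⊆ t → 𝒱 s → 𝒱 t)
    (h k ha hb ka kb : Set V → ℝ)
    (mha : Monotone ha) (mhb : Monotone hb) (mka : Monotone ka) (mkb : Monotone kb)
    (h01 : ∀ S, h S = 0 ∨ h S = 1) (k01 : ∀ S, k S = 0 ∨ k S = 1) (ha01 : ∀ S, ha S = 0 ∨ ha S = 1) (hb01 : ∀ S, hb S = 0 ∨ hb S = 1)
    (ka01 : ∀ S, ka S = 0 ∨ ka S = 1) (kb01 : ∀ S, kb S = 0 ∨ kb S = 1)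
    (hah : ∀ S, ha S ≤ h S) (hbh : ∀ S, hb S ≤ h S) (kak : ∀ S, ka S ≤ k S) (kbk : ∀ S, kb S ≤ k S)
    (sha : ∀ S S' : Set V, (∀ j, j ≤ L p → (w p j ∈ S ↔ w p j ∈ S')) → ha S = ha S')
    (shb : ∀ S S' : Set V, (∀ j, j ≤ L p → (w p j ∈ S ↔ w p j ∈ S')) → hb S = hb S')
    (ska : ∀ S S' : Set V, (∀ j, j ≤ L q → (w q j ∈ S ↔ w q j ∈ S')) → ka S = ka S')
    (skb : ∀ S S' : Set V, (∀ j, j ≤ L q → (w q j ∈ S ↔ w q j ∈ S')) → kb S = kb S')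
    (hau : ha {u} = 0) (kau : ka {u} = 0) :
    0 ≤ (∑ ω ∈ E.powerset, if 𝒱 ω ∧ b ∈ openCluster (ends '' (↑ω : Set ι)) u ∧ b ∉ openCluster (ends '' (↑(E \ ω) : Set ι)) u then
        h (openCluster (ends '' (↑ω : Set ι)) u) * k (openCluster (ends '' (↑ω : Set ι)) u) else 0)
      + ∑ ω ∈ E.powerset, if 𝒱 ω ∧ b ∈ openCluster (ends '' (↑(E \ ω) : Set ι)) u ∧ b ∉ openCluster (ends '' (↑ω : Set ι)) u then
        (ha (openCluster (ends '' (↑ω : Set ι)) u) - hb (openCluster (ends '' (↑(E \ ω) : Set ι)) u)) *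
          (ka (openCluster (ends '' (↑ω : Set ι)) u) - kb (openCluster (ends '' (↑(E \ ω) : Set ι)) u)) else 0 := by
  set C : Finset ι → Set V := fun ω => openCluster (ends '' (↑ω : Set ι)) u with hC
  -- ## bundle bookkeeping
  have hr : 0 < r := lt_of_le_of_lt (Nat.zero_le p) hp
  have hAE : ∀ t, t < r → A t ⊆ E := fun t ht i hi => (hEA i).mpr ⟨t, ht, hi⟩
  have heA : ∀ t, t < r → ∀ j, 1 ≤ j → j ≤ L t → e t j ∈ A t := fun t ht j hj1 hjL => (hA t ht _).mpr ⟨j, hj1, hjL, rfl⟩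
  have hAne : ∀ t, t < r → (A t).Nonempty := fun t ht => ⟨e t 1, heA t ht 1 (le_refl 1) (hL t ht)⟩
  -- full threads and b
  have full_iff : ∀ ω : Finset ι, ω ⊆ E → (b ∈ C ω ↔ ∃ t, t < r ∧ A t ⊆ ω) := fun ω hω =>
    bundle_b_mem_cluster_iff_threads ends r L hL w e u b hr hw0 hwL harc hwinj hcross A hA E hEA ω hω
  -- ## the three parts
  set P : Finset ι := A p with hP
  set Q : Finset ι := A q with hQ
  set O : Finset ι := E \ (P ∪ Q) with hO
  set T : Finset ℕ := (Finset.range r).filter (fun t => t ≠ p ∧ t ≠ q) with hT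
  have memT : ∀ t, t ∈ T ↔ (t < r ∧ t ≠ p ∧ t ≠ q) := by
    intro t; rw [hT, Finset.mem_filter, Finset.mem_range]
  have hPQ : Disjoint P Q := hAdisj p q hp hq hpq
  have hPO : Disjoint P O := by
    rw [hO]; exact Finset.disjoint_left.mpr fun i hi hi' => (Finset.mem_sdiff.mp hi').2 (Finset.mem_union_left _ hi)
  have hQO : Disjoint Q O := by
    rw [hO]; exact Finset.disjoint_left.mpr fun i hi hi' => (Finset.mem_sdiff.mp hi').2 (Finset.mem_union_right _ hi)
  have hPQO : P ∪ Q ∪ O = E := by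
    rw [hO]; exact Finset.union_sdiff_of_subset (Finset.union_subset (hAE p hp) (hAE q hq))
  have hAO : ∀ t, t ∈ T → A t ⊆ O := by
    intro t ht i hi
    obtain ⟨htr, htp, htq⟩ := (memT t).mp ht
    rw [hO, Finset.mem_sdiff, Finset.mem_union]
    refine ⟨hAE t htr hi, ?_⟩
    rintro (h1 | h1)
    · exact Finset.disjoint_left.mp (hAdisj t p htr hp htp) hi h1
    · exact Finset.disjoint_left.mp (hAdisj t q htr hq htq) hi h1
  have hTdisj : ∀ t ∈ T, ∀ t' ∈ T, t ≠ t' → Disjoint (A t) (A t') :=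
    fun t ht t' ht' htt => hAdisj t t' ((memT t).mp ht).1 ((memT t').mp ht').1 htt
  -- ## the word predicates
  set XD : ℕ → Finset ι → Set V := fun t a => {x | ∃ j, j < L t ∧ x = w t j ∧ ∀ j', 1 ≤ j' → j' ≤ j → e t j' ∈ a} with hXD
  set YD : ℕ → Finset ι → Set V := fun t a =>
    {x | ∃ j, j ≤ L t ∧ x = w t j ∧ ((∀ j', 1 ≤ j' → j' ≤ j → e t j' ∉ a) ∨ (∀ j', j < j' → j' ≤ L t → e t j' ∉ a))} with hYD
  -- (the status predicates are introduced as opaque functions with defining equations, so that every `if` below is decided classically)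
  obtain ⟨hro, hhro⟩ : ∃ f : Finset ι → Prop, f = fun a => ha (XD p a) = 1 ∧ hb (YD p a) = 0 := ⟨_, rfl⟩
  obtain ⟨hbo, hhbo⟩ : ∃ f : Finset ι → Prop, f = fun a => hb (YD p a) = 1 ∧ ha (XD p a) = 0 := ⟨_, rfl⟩
  obtain ⟨kro, hkro⟩ : ∃ f : Finset ι → Prop, f = fun g => ka (XD q g) = 1 ∧ kb (YD q g) = 0 := ⟨_, rfl⟩
  obtain ⟨kbo, hkbo⟩ : ∃ f : Finset ι → Prop, f = fun g => kb (YD q g) = 1 ∧ ka (XD q g) = 0 := ⟨_, rfl⟩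
  obtain ⟨noF, hnoF⟩ : ∃ f : Finset ι → Prop, f = fun η => ∀ t ∈ T, ¬ A t ⊆ η := ⟨_, rfl⟩
  obtain ⟨hasE, hhasE⟩ : ∃ f : Finset ι → Prop, f = fun η => ∃ t ∈ T, Disjoint (A t) η := ⟨_, rfl⟩
  set lift : Finset ι → Finset ι := fun η => η ∪ (T.filter (fun t => Disjoint (A t) η)).biUnion A with hlift
  -- monotonicity of the traces in the word
  have XD_mono : ∀ t (a a' : Finset ι), a ⊆ a' → XD t a ⊆ XD t a' := by
    intro t a a' haa' x hx
    simp only [hXD, Set.mem_setOf_eq] at hx ⊢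
    obtain ⟨j, hjL, hx, hrun⟩ := hx
    exact ⟨j, hjL, hx, fun j' h1 h2 => haa' (hrun j' h1 h2)⟩
  have YD_anti : ∀ t (a a' : Finset ι), a ⊆ a' → YD t a' ⊆ YD t a := by
    intro t a a' haa' x hx
    simp only [hYD, Set.mem_setOf_eq] at hx ⊢
    obtain ⟨j, hjL, hx, hrun⟩ := hx
    refine ⟨j, hjL, hx, ?_⟩
    rcases hrun with hrun | hrun
    · exact Or.inl fun j' h1 h2 hm => hrun j' h1 h2 (haa' hm)
    · exact Or.inr fun j' h1 h2 hm => hrun j' h1 h2 (haa' hm)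
  -- 0/1 bookkeeping
  have one_of_ge : ∀ (f : Set V → ℝ), (∀ S, f S = 0 ∨ f S = 1) → ∀ S S', S ⊆ S' → Monotone f → f S = 1 → f S' = 1 := by
    intro f f01 S S' hSS' mf h1
    rcases f01 S' with h0 | h0
    · have := mf hSS'; rw [h1, h0] at this; linarith
    · exact h0
  have zero_of_le : ∀ (f : Set V → ℝ), (∀ S, f S = 0 ∨ f S = 1) → ∀ S S', S ⊆ S' → Monotone f → f S' = 0 → f S = 0 := by
    intro f f01 S S' hSS' mf h0
    rcases f01 S with h1 | h1
    · exact h1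
    · have := mf hSS'; rw [h1, h0] at this; linarith
  have hbo_anti : ∀ a a' : Finset ι, a ⊆ a' → a' ⊆ P → hbo a' → hbo a := by
    intro a a' haa' _ hh
    simp only [hhbo] at hh ⊢
    exact ⟨one_of_ge hb hb01 _ _ (YD_anti p a a' haa') mhb hh.1, zero_of_le ha ha01 _ _ (XD_mono p a a' haa') mha hh.2⟩
  have kbo_anti : ∀ g g' : Finset ι, g ⊆ g' → g' ⊆ Q → kbo g' → kbo g := by
    intro g g' hgg' _ hh
    simp only [hkbo] at hh ⊢
    exact ⟨one_of_ge kb kb01 _ _ (YD_anti q g g' hgg') mkb hh.1, zero_of_le ka ka01 _ _ (XD_mono q g g' hgg') mka hh.2⟩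
  -- the lift
  have lift_sub : ∀ η, η ⊆ O → lift η ⊆ O := by
    intro η hη i hi
    simp only [hlift] at hi
    rcases (bundle_mem_lift_iff T A η i).mp hi with h1 | ⟨t, htT, _, hit⟩
    · exact hη h1
    · exact hAO t htT hit
  have sub_lift : ∀ η, η ⊆ O → η ⊆ lift η := by
    intro η _ i hi; simp only [hlift]; exact Finset.mem_union_left _ hi
  have lift_inj : ∀ η η', η ⊆ O → η' ⊆ O → noF η → noF η' → lift η = lift η' → η = η' := by
    intro η η' _ _ hnf hnf' hl
    simp only [hnoF] at hnf hnf'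
    simp only [hlift] at hl
    exact bundle_lift_injOn T A hTdisj η η' hnf hnf' hl
  -- ## the abstract flows-with-joins count
  have key := fibre_flows_joins P Q O hPQ hPO hQO 𝒱 hV hro hbo kro kbo noF hasE lift hbo_anti kbo_anti lift_sub sub_lift lift_inj
  rw [hPQO] at key
  -- ## identification of the demand region
  have Dabs_iff : ∀ ω : Finset ι, ω ⊆ E →
      ((ω ∩ P ≠ P ∧ ω ∩ Q ≠ Q ∧ noF (ω ∩ O) ∧ (ω ∩ P = ∅ ∨ ω ∩ Q = ∅ ∨ hasE (ω ∩ O))) ↔ (b ∈ C (E \ ω) ∧ b ∉ C ω)) := by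
    intro ω hω
    rw [hnoF, hhasE]
    exact bundle_demand_iff ends r L hL w e u b hw0 hwL harc hwinj hcross A hA hAdisj E hEA p q hp hq ω hω
  -- ## identification of the levels at demand points (exact traces + thread support)
  have trX : ∀ ω : Finset ι, ω ⊆ E → b ∉ C ω → ∀ t, t < r → ∀ j, j ≤ L t → (w t j ∈ C ω ↔ w t j ∈ XD t (ω ∩ A t)) :=
    fun ω hω hbX t ht j hj => bundle_traceD_iff ends r L hL w e u b hw0 hwL harc hwinj hcross A hA E hEA ω hω hbX t ht j hj
  have trY : ∀ ω : Finset ι, b ∈ C (E \ ω) → ∀ t, t < r → ∀ j, j ≤ L t → (w t j ∈ C (E \ ω) ↔ w t j ∈ YD t (ω ∩ A t)) :=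
    fun ω hbY t ht j hj => bundle_traceDc_iff ends r L w e u b hw0 hwL harc hwinj hcross A hA E hEA ω hbY t ht j hj
  have lev : ∀ ω : Finset ι, ω ⊆ E → b ∈ C (E \ ω) → b ∉ C ω →
      ha (C ω) = ha (XD p (ω ∩ P)) ∧ hb (C (E \ ω)) = hb (YD p (ω ∩ P)) ∧ ka (C ω) = ka (XD q (ω ∩ Q)) ∧ kb (C (E \ ω)) = kb (YD q (ω ∩ Q)) := by
    intro ω hω hbY hbX
    exact ⟨sha _ _ (trX ω hω hbX p hp), shb _ _ (trY ω hbY p hp), ska _ _ (trX ω hω hbX q hq), skb _ _ (trY ω hbY q hq)⟩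
  -- ## the flow images lie in the supply
  have supXD : ∀ (ω : Finset ι) t, t < r → ∀ a : Finset ι, a ⊆ ω → XD t a ⊆ C ω := by
    intro ω t ht a haω x hx
    simp only [hXD, Set.mem_setOf_eq] at hx
    obtain ⟨j, hjL, rfl, hrun⟩ := hx
    exact bundle_prefix_mem_cluster ends r L w e u hw0 harc ω t ht j (le_of_lt hjL) fun j' h1 h2 => haω (hrun j' h1 h2)
  have supYD : ∀ (ω : Finset ι) t, t < r → b ∈ C ω → ∀ g : Finset ι, (∀ j, 1 ≤ j → j ≤ L t → e t j ∉ g → e t j ∈ ω) → YD t g ⊆ C ω := by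
    intro ω t ht hbω g hg x hx
    simp only [hYD, Set.mem_setOf_eq] at hx
    obtain ⟨j, hjL, rfl, hruns⟩ := hx
    rcases hruns with hrun | hrun
    · exact bundle_prefix_mem_cluster ends r L w e u hw0 harc ω t ht j hjL fun j' h1 h2 => hg j' h1 (by omega) (hrun j' h1 h2)
    · exact bundle_suffix_mem_cluster ends r L w e u b hwL harc ω hbω t ht j hjL fun j' h1 h2 => hg j' (by omega) h2 (hrun j' h1 h2)
  have XD_empty : ∀ t, t < r → XD t ∅ ⊆ {u} := by
    intro t ht x hx
    simp only [hXD, Set.mem_setOf_eq] at hx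
    obtain ⟨j, hjL, rfl, hrun⟩ := hx
    have hj0 : j = 0 := by
      by_contra hj0
      exact Finset.notMem_empty _ (hrun 1 (le_refl 1) (by omega))
    rw [hj0, hw0 t ht]; exact Set.mem_singleton u
  have c4 : ∀ ω ∈ E.powerset, (𝒱 ω ∧ ((hro (ω ∩ P) ∧ kbo (Q \ ω) ∧ ω ∩ P ≠ P ∧ ω ∩ Q ≠ ∅ ∧
                      ∃ η, η ⊆ O ∧ noF η ∧ lift η = ω ∩ O ∧ (ω ∩ P = ∅ ∨ ω ∩ Q = Q ∨ hasE η))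
                  ∨ (kro (ω ∩ Q) ∧ hbo (P \ ω) ∧ ω ∩ Q ≠ Q ∧ ω ∩ P ≠ ∅ ∧
                      ∃ η, η ⊆ O ∧ noF η ∧ lift η = ω ∩ O ∧ (ω ∩ Q = ∅ ∨ ω ∩ P = P ∨ hasE η)))) →
      ((𝒱 ω ∧ b ∈ C ω ∧ b ∉ C (E \ ω)) ∧ h (C ω) = 1 ∧ k (C ω) = 1) := by
    intro ω hω hc
    have hωE : ω ⊆ E := Finset.mem_powerset.mp hω
    obtain ⟨hv, hc⟩ := hc
    -- from 0/1 sublevels to the levels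
    have up1 : ∀ (f g : Set V → ℝ), (∀ S, g S = 0 ∨ g S = 1) → (∀ S, f S ≤ g S) → f (C ω) = 1 → g (C ω) = 1 := by
      intro f g g01 hfg e1
      rcases g01 (C ω) with h0 | h0
      · have := hfg (C ω); rw [e1, h0] at this; linarith
      · exact h0
    -- an empty thread of `ω` is not `p`, not `q` (the words are nonempty) and not another thread (the lift filled it)
    have noEmpty : ∀ η : Finset ι, lift η = ω ∩ O → ω ∩ P ≠ ∅ → ω ∩ Q ≠ ∅ → b ∉ C (E \ ω) := by
      intro η hlη hPne hQne
      rw [full_iff (E \ ω) Finset.sdiff_subset]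
      rintro ⟨t, htr, hsub⟩
      have hdis : Disjoint (A t) ω := Finset.disjoint_left.mpr fun i hi hiω => (Finset.mem_sdiff.mp (hsub hi)).2 hiω
      by_cases htp : t = p
      · apply hPne; rw [htp] at hdis; exact Finset.disjoint_iff_inter_eq_empty.mp hdis.symm
      by_cases htq : t = q
      · apply hQne; rw [htq] at hdis; exact Finset.disjoint_iff_inter_eq_empty.mp hdis.symm
      have htT : t ∈ T := (memT t).mpr ⟨htr, htp, htq⟩
      apply bundle_lift_meets T A η t htT (hAne t htr)
      have hl : η ∪ (T.filter (fun t => Disjoint (A t) η)).biUnion A = ω ∩ O := by rw [← hlη, hlift]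
      rw [hl]
      exact Finset.disjoint_of_subset_right Finset.inter_subset_left hdis
    -- a thread filled by the lift is full
    have fullOfE : ∀ η : Finset ι, lift η = ω ∩ O → hasE η → b ∈ C ω := by
      intro η hlη hE'
      simp only [hhasE] at hE'
      obtain ⟨t, htT, hdisj⟩ := hE'
      rw [full_iff ω hωE]
      refine ⟨t, ((memT t).mp htT).1, ?_⟩
      have hsub : A t ⊆ lift η := by rw [hlift]; exact bundle_subset_lift_of_disjoint T A η t htT hdisj
      rw [hlη] at hsub
      exact fun i hi => (Finset.mem_inter.mp (hsub hi)).1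
    rcases hc with ⟨h1, h2, -, h4, η, -, -, hlη, h5⟩ | ⟨h1, h2, -, h4, η, -, -, hlη, h5⟩
    · -- image of flow 1
      simp only [hhro] at h1
      simp only [hkbo] at h2
      have hPne : ω ∩ P ≠ ∅ := by
        intro h0
        rw [h0] at h1
        have hle : ha (XD p ∅) ≤ ha {u} := mha (XD_empty p hp)
        rw [h1.1, hau] at hle; linarith
      have hbX : b ∈ C ω := by
        rcases h5 with h5 | h5 | h5
        · exact absurd h5 hPne
        · rw [full_iff ω hωE]; exact ⟨q, hq, Finset.inter_eq_right.mp h5⟩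
        · exact fullOfE η hlη h5
      have hbY : b ∉ C (E \ ω) := noEmpty η hlη hPne h4
      have e1 : ha (C ω) = 1 := one_of_ge ha ha01 _ _ (supXD ω p hp (ω ∩ P) Finset.inter_subset_left) mha h1.1
      have e2 : kb (C ω) = 1 := by
        refine one_of_ge kb kb01 _ _ (supYD ω q hq hbX (Q \ ω) ?_) mkb h2.1
        intro j hj1 hjL hnot
        by_contra hjω
        exact hnot (Finset.mem_sdiff.mpr ⟨heA q hq j hj1 hjL, hjω⟩)
      exact ⟨⟨hv, hbX, hbY⟩, up1 ha h h01 hah e1, up1 kb k k01 kbk e2⟩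
    · -- image of flow 2
      simp only [hkro] at h1
      simp only [hhbo] at h2
      have hQne : ω ∩ Q ≠ ∅ := by
        intro h0
        rw [h0] at h1
        have hle : ka (XD q ∅) ≤ ka {u} := mka (XD_empty q hq)
        rw [h1.1, kau] at hle; linarith
      have hbX : b ∈ C ω := by
        rcases h5 with h5 | h5 | h5
        · exact absurd h5 hQne
        · rw [full_iff ω hωE]; exact ⟨p, hp, Finset.inter_eq_right.mp h5⟩
        · exact fullOfE η hlη h5
      have hbY : b ∉ C (E \ ω) := noEmpty η hlη h4 hQne
      have e1 : ka (C ω) = 1 := one_of_ge ka ka01 _ _ (supXD ω q hq (ω ∩ Q) Finset.inter_subset_left) mka h1.1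
      have e2 : hb (C ω) = 1 := by
        refine one_of_ge hb hb01 _ _ (supYD ω p hp hbX (P \ ω) ?_) mhb h2.1
        intro j hj1 hjL hnot
        by_contra hjω
        exact hnot (Finset.mem_sdiff.mpr ⟨heA p hp j hj1 hjL, hjω⟩)
      exact ⟨⟨hv, hbX, hbY⟩, up1 hb h h01 hbh e2, up1 ka k k01 kak e1⟩
  -- ## the four comparisons of sums
  have cD : ∀ ω ∈ E.powerset, ∀ (Φ Ψ : Prop), (b ∈ C (E \ ω) → b ∉ C ω → (Φ ↔ Ψ)) →
      ((𝒱 ω ∧ (ω ∩ P ≠ P ∧ ω ∩ Q ≠ Q ∧ noF (ω ∩ O) ∧ (ω ∩ P = ∅ ∨ ω ∩ Q = ∅ ∨ hasE (ω ∩ O))) ∧ Φ) ↔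
        ((𝒱 ω ∧ b ∈ C (E \ ω) ∧ b ∉ C ω) ∧ Ψ)) := by
    intro ω hω Φ Ψ hΦΨ
    have hD := Dabs_iff ω (Finset.mem_powerset.mp hω)
    constructor
    · rintro ⟨hv, hD', hΦ⟩
      obtain ⟨hbY, hbX⟩ := hD.mp hD'
      exact ⟨⟨hv, hbY, hbX⟩, (hΦΨ hbY hbX).mp hΦ⟩
    · rintro ⟨⟨hv, hbY, hbX⟩, hΨ⟩
      exact ⟨hv, hD.mpr ⟨hbY, hbX⟩, (hΦΨ hbY hbX).mpr hΨ⟩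
  have c1 : ∀ ω ∈ E.powerset,
      (𝒱 ω ∧ ((ω ∩ P ≠ P ∧ ω ∩ Q ≠ Q ∧ noF (ω ∩ O) ∧ (ω ∩ P = ∅ ∨ ω ∩ Q = ∅ ∨ hasE (ω ∩ O))) ∧ hro (ω ∩ P) ∧ kbo (ω ∩ Q)) ↔
      ((𝒱 ω ∧ b ∈ C (E \ ω) ∧ b ∉ C ω) ∧ ha (C ω) = 1 ∧ kb (C (E \ ω)) = 1 ∧ hb (C (E \ ω)) = 0 ∧ ka (C ω) = 0)) := by
    intro ω hω
    refine cD ω hω _ _ fun hbY hbX => ?_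
    obtain ⟨e1, e2, e3, e4⟩ := lev ω (Finset.mem_powerset.mp hω) hbY hbX
    rw [hhro, hkbo, e1, e2, e3, e4]; tauto
  have c2 : ∀ ω ∈ E.powerset,
      (𝒱 ω ∧ ((ω ∩ P ≠ P ∧ ω ∩ Q ≠ Q ∧ noF (ω ∩ O) ∧ (ω ∩ P = ∅ ∨ ω ∩ Q = ∅ ∨ hasE (ω ∩ O))) ∧ hbo (ω ∩ P) ∧ kro (ω ∩ Q)) ↔
      ((𝒱 ω ∧ b ∈ C (E \ ω) ∧ b ∉ C ω) ∧ hb (C (E \ ω)) = 1 ∧ ka (C ω) = 1 ∧ ha (C ω) = 0 ∧ kb (C (E \ ω)) = 0)) := by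
    intro ω hω
    refine cD ω hω _ _ fun hbY hbX => ?_
    obtain ⟨e1, e2, e3, e4⟩ := lev ω (Finset.mem_powerset.mp hω) hbY hbX
    rw [hhbo, hkro, e1, e2, e3, e4]; tauto
  have c3 : ∀ ω ∈ E.powerset,
      (𝒱 ω ∧ ((ω ∩ P ≠ P ∧ ω ∩ Q ≠ Q ∧ noF (ω ∩ O) ∧ (ω ∩ P = ∅ ∨ ω ∩ Q = ∅ ∨ hasE (ω ∩ O))) ∧ hro (ω ∩ P) ∧ kro (ω ∩ Q)) ↔
      ((𝒱 ω ∧ b ∈ C (E \ ω) ∧ b ∉ C ω) ∧ ha (C ω) = 1 ∧ ka (C ω) = 1 ∧ hb (C (E \ ω)) = 0 ∧ kb (C (E \ ω)) = 0)) := by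
    intro ω hω
    refine cD ω hω _ _ fun hbY hbX => ?_
    obtain ⟨e1, e2, e3, e4⟩ := lev ω (Finset.mem_powerset.mp hω) hbY hbX
    rw [hhro, hkro, e1, e2, e3, e4]; tauto
  -- ## the 0/1 form dominates the count
  have cnt : (∑ ω ∈ E.powerset, if (𝒱 ω ∧ b ∈ C ω ∧ b ∉ C (E \ ω)) ∧ h (C ω) = 1 ∧ k (C ω) = 1 then (1 : ℝ) else 0)
      + (∑ ω ∈ E.powerset, if (𝒱 ω ∧ b ∈ C (E \ ω) ∧ b ∉ C ω) ∧ ha (C ω) = 1 ∧ ka (C ω) = 1 ∧ hb (C (E \ ω)) = 0 ∧ kb (C (E \ ω)) = 0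
          then (1 : ℝ) else 0)
      - (∑ ω ∈ E.powerset, if (𝒱 ω ∧ b ∈ C (E \ ω) ∧ b ∉ C ω) ∧ ha (C ω) = 1 ∧ kb (C (E \ ω)) = 1 ∧ hb (C (E \ ω)) = 0 ∧ ka (C ω) = 0
          then (1 : ℝ) else 0)
      - (∑ ω ∈ E.powerset, if (𝒱 ω ∧ b ∈ C (E \ ω) ∧ b ∉ C ω) ∧ hb (C (E \ ω)) = 1 ∧ ka (C ω) = 1 ∧ ha (C ω) = 0 ∧ kb (C (E \ ω)) = 0
          then (1 : ℝ) else 0)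
    ≤ (∑ ω ∈ E.powerset, if 𝒱 ω ∧ b ∈ C ω ∧ b ∉ C (E \ ω) then h (C ω) * k (C ω) else 0)
      + ∑ ω ∈ E.powerset, if 𝒱 ω ∧ b ∈ C (E \ ω) ∧ b ∉ C ω then (ha (C ω) - hb (C (E \ ω))) * (ka (C ω) - kb (C (E \ ω))) else 0 :=
    iet01_ge_count E (fun ω => 𝒱 ω ∧ b ∈ C ω ∧ b ∉ C (E \ ω)) (fun ω => 𝒱 ω ∧ b ∈ C (E \ ω) ∧ b ∉ C ω)
      C (fun ω => C (E \ ω)) h k ha hb ka kb h01 k01 ha01 hb01 ka01 kb01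
  -- ## assemble (the abstract sums are identified with the cluster counts termwise)
  have fin : ∀ S₁ S₂ S₃ S₄ : ℝ, S₁ + S₂ ≤ S₃ + S₄ →
      S₁ = (∑ ω ∈ E.powerset, if (𝒱 ω ∧ b ∈ C (E \ ω) ∧ b ∉ C ω) ∧ ha (C ω) = 1 ∧ kb (C (E \ ω)) = 1 ∧ hb (C (E \ ω)) = 0 ∧ ka (C ω) = 0
          then (1 : ℝ) else 0) →
      S₂ = (∑ ω ∈ E.powerset, if (𝒱 ω ∧ b ∈ C (E \ ω) ∧ b ∉ C ω) ∧ hb (C (E \ ω)) = 1 ∧ ka (C ω) = 1 ∧ ha (C ω) = 0 ∧ kb (C (E \ ω)) = 0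
          then (1 : ℝ) else 0) →
      S₄ = (∑ ω ∈ E.powerset, if (𝒱 ω ∧ b ∈ C (E \ ω) ∧ b ∉ C ω) ∧ ha (C ω) = 1 ∧ ka (C ω) = 1 ∧ hb (C (E \ ω)) = 0 ∧ kb (C (E \ ω)) = 0
          then (1 : ℝ) else 0) →
      S₃ ≤ (∑ ω ∈ E.powerset, if (𝒱 ω ∧ b ∈ C ω ∧ b ∉ C (E \ ω)) ∧ h (C ω) = 1 ∧ k (C ω) = 1 then (1 : ℝ) else 0) →
      0 ≤ (∑ ω ∈ E.powerset, if 𝒱 ω ∧ b ∈ C ω ∧ b ∉ C (E \ ω) then h (C ω) * k (C ω) else 0)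
        + ∑ ω ∈ E.powerset, if 𝒱 ω ∧ b ∈ C (E \ ω) ∧ b ∉ C ω then (ha (C ω) - hb (C (E \ ω))) * (ka (C ω) - kb (C (E \ ω))) else 0 := by
    intro S₁ S₂ S₃ S₄ hk e1 e2 e4 e3
    linarith
  refine fin _ _ _ _ key (Finset.sum_congr rfl fun ω hω => if_congr (c1 ω hω) rfl rfl)
    (Finset.sum_congr rfl fun ω hω => if_congr (c2 ω hω) rfl rfl) (Finset.sum_congr rfl fun ω hω => if_congr (c3 ω hω) rfl rfl) ?_
  refine Finset.sum_le_sum fun ω hω => ?_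
  by_cases hc : 𝒱 ω ∧ ((hro (ω ∩ P) ∧ kbo (Q \ ω) ∧ ω ∩ P ≠ P ∧ ω ∩ Q ≠ ∅ ∧
                      ∃ η, η ⊆ O ∧ noF η ∧ lift η = ω ∩ O ∧ (ω ∩ P = ∅ ∨ ω ∩ Q = Q ∨ hasE η))
                  ∨ (kro (ω ∩ Q) ∧ hbo (P \ ω) ∧ ω ∩ Q ≠ Q ∧ ω ∩ P ≠ ∅ ∧
                      ∃ η, η ⊆ O ∧ noF η ∧ lift η = ω ∩ O ∧ (ω ∩ Q = ∅ ∨ ω ∩ P = P ∨ hasE η)))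
  · rw [if_pos hc, if_pos (c4 ω hω hc)]
  · rw [if_neg hc]; split_ifs <;> norm_num

end Coefficientwise

end Summit.CriticalPhenomena.PercolationContinuityZ3.Theorems
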